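import Summits.AtomisticToContinuum.HydrodynamicLimit.Theorems.MourreKoopmanChargesLinearToEntropyInBandWindowClauseCovering
import HarnessLib

/-!
# Route `MourreKoopmanCharges`, crux `LinearToEntropyInBand` (stmt-AtomisticToContinuum-17740), skeleton v8:
# the Euler flux of the VISIBLE block fields at the constant diagonal test field is bounded (flux half of RINGS-VLFG § 1)

Support file (`--supports stmt-AtomisticToContinuum-17740`; registered helper `stub_visCoreDiagFluxBound`, the
flux part (B) of the helper target `stub_visCoreDiagLowerBound`; worker of lead prover-line-…-17740-c6-0, wave 1;
memo `Cruxes/LinearToEntropyInBand/RINGS-VLFG.md` § 1).  Objects of `…LinearToEntropyInBandDefs` § 2 (the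
`M`-system: `Cfg`, `FlowFamily`, `cone`, `Visible`, the `let flux` of `visCore`) at the test fields `A₀ = A₄ = 0`,
`A j = fun _ => β • e_j`, for which the Euler-flux integrand is `β (⟪m̄, w̄⟫ + 3 p)` (`…VisCoreDiagLowerBound` § 1):

* § 1 `Visible R K M = VisibleN 1 0 R K M` and the visible block density of the `M`-system is `visDensityN 1 0`, so the
  landed covering lemma `visDensityN_le_geometric` (`…WindowClauseCovering` § 4) reads: for `0 < R`, `0 < k`,
  `R (M+1)^{-1/3} ≤ 4`, at EVERY configuration and every point `ρ̄ ≤ 3 (8 + R/k)³` (`visDensity_le_geometric`).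
* § 2 `abs_diagFluxDensity_le`: `|⟪m̄, w̄⟫ + 3 p| ≤ D K² (1 + Zb)` where `ρ̄(x) ≤ D` (`0 ≤ K`, `0 ≤ k`, `0 ≤ σ'`,
  `|Z| ≤ Zb` on `[0, 2σ'³]`, the range of the capped EOS argument `min(ρ̄, 2) σ'³`; `‖m̄‖ ≤ K ρ̄`, `0 ≤ ē ≤ K² ρ̄/2`,
  `‖w̄‖ ≤ K` with the junk `ρ̄⁻¹ = 0`, `|p| ≤ K² Zb ρ̄/3` — the M-system twins of `norm_visMomentumN_le`,
  `visEnergyN_mem_Icc`, `abs_visFluxDensityN_le` of `…VisCoreNToolkitC`); `abs_diagFlux_le`: `|flux(y)| ≤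
  (M+1) β D K² (1 + Zb)` (`vol 𝕋³ = 1`; NO integrability needed, Bochner junk `0` included); `abs_windowFlux_diag_le`:
  along any orbit `|∫₀^τ flux| ≤ τ (M+1) β C₃`, `C₃ = 3 (8 + R/k)³ K² (1 + Zb)` (interval-integral junk included).

Nothing here restates the crux, a stub, a neighbour's stub or the Statement; no definition, no posited object.
References: S. Olla, S. R. S. Varadhan, H.-T. Yau, Commun. Math. Phys. 155 (1993) § 4 (block averages and cut-offs);
H. Spohn, *Large Scale Dynamics of Interacting Particles* (1991) Part I § 3.3.
-/

noncomputable section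

open MeasureTheory Filter Set
open scoped ENNReal Topology InnerProductSpace BigOperators

namespace Summit.AtomisticToContinuum.HydrodynamicLimit.Theorems.LTEInBand

open Literature.MathematicalPhysics.KineticTheory Literature.Analysis.FluidPDE Literature.Analysis.FunctionSpaces

/-! ## § 1 The covering lemma for the `M`-system -/

section Covering

/-- `Visible` of the unit-density `M`-system is `VisibleN` with frozen fields `ρs = 1`, `us = 0`. -/
theorem visible_iff_visibleN (R K : ℝ) (M : ℕ) (y : Cfg M) (i : Fin (M + 1)) :
    Visible R K M y i ↔ VisibleN (fun _ => 1) (fun _ => 0) R K M y i := by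
  unfold Visible VisibleN
  rw [sub_zero, mul_one]

/-- The visible block density of the `M`-system is `visDensityN 1 0`. -/
theorem visDensity_eq_visDensityN (R K k : ℝ) (M : ℕ) (y : Cfg M) (x : T3) :
    ((M : ℝ) + 1)⁻¹ * ∑ i, (if Visible R K M y i then cone k M x (y i).1 else 0) =
      visDensityN (fun _ => 1) (fun _ => 0) R K k M y x := by
  unfold visDensityN
  simp only [visible_iff_visibleN]

/-- **Covering bound for the `M`-system**: the visible block density is at most `3 (8 + R/k)³` at every
configuration and every point (`visDensityN_le_geometric` with `ρs = 1`). -/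
theorem visDensity_le_geometric {R K k : ℝ} {M : ℕ} (hR : 0 < R) (hk : 0 < k)
    (hRν : R * ((M : ℝ) + 1) ^ (-(1 / 3 : ℝ)) ≤ 4) (y : Cfg M) (x : T3) :
    ((M : ℝ) + 1)⁻¹ * ∑ i, (if Visible R K M y i then cone k M x (y i).1 else 0) ≤ 3 * (8 + R / k) ^ 3 := by
  rw [visDensity_eq_visDensityN]
  simpa using visDensityN_le_geometric (ρs := fun _ => 1) (us := fun _ => 0) (K := K) hR hk hRν zero_le_one
    (fun _ => le_rfl) y x

end Covering

/-! ## § 2 The Euler flux of the visible block fields at the diagonal test field -/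

section Flux

/-- **Visible-particle bound of the Euler-flux density of the diagonal field**: with `0 ≤ K`, `0 ≤ k`,
`0 ≤ σ'`, the compressibility factor bounded by `Zb` on `[0, 2σ'³]` (the range of the capped EOS argument
`min(ρ̄, 2) σ'³`) and the visible block density at `x` at most `D`, the integrand `⟪m̄, w̄⟫ + 3 p` of the
diagonal flux is at most `D K² (1 + Zb)` in absolute value (`‖m̄‖ ≤ K ρ̄`, `0 ≤ ē ≤ K² ρ̄ / 2`, `‖w̄‖ ≤ K`,
`|p| ≤ K² Zb ρ̄ / 3`; junk `ρ̄⁻¹ = 0` included). -/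
theorem abs_diagFluxDensity_le {R K k σ' D Zb : ℝ} {M : ℕ} (hK : 0 ≤ K) (hk : 0 ≤ k) (hσ : 0 ≤ σ')
    (hZ : ∀ η ∈ Set.Icc 0 (2 * σ' ^ 3), |hsCompressibility η| ≤ Zb) (y : Cfg M) (x : T3)
    (hD : ((M : ℝ) + 1)⁻¹ * ∑ i, (if Visible R K M y i then cone k M x (y i).1 else 0) ≤ D) :
    let ρ : ℝ := ((M : ℝ) + 1)⁻¹ * ∑ i, (if Visible R K M y i then cone k M x (y i).1 else 0)
    let m : V3 := ((M : ℝ) + 1)⁻¹ • ∑ i, (if Visible R K M y i then cone k M x (y i).1 • (y i).2 else 0)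
    let e : ℝ := ((M : ℝ) + 1)⁻¹ * ∑ i, (if Visible R K M y i then cone k M x (y i).1 * ‖(y i).2‖ ^ 2 / 2 else 0)
    let w : V3 := ρ⁻¹ • m
    let p : ℝ := ρ * (2 / 3 * (e / ρ - ‖w‖ ^ 2 / 2)) * hsCompressibility (min ρ 2 * σ' ^ 3)
    |⟪m, w⟫_ℝ + 3 * p| ≤ D * K ^ 2 * (1 + Zb) := by
  intro ρ m e w p
  have hc : ∀ i, 0 ≤ cone k M x (y i).1 := fun i => cone_nonneg M hk x _
  have hρ0 : 0 ≤ ρ :=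
    mul_nonneg (by positivity) (Finset.sum_nonneg fun i _ => by split_ifs; exacts [hc i, le_rfl])
  have hρD : ρ ≤ D := hD
  have hm : ‖m‖ ≤ K * ρ := by
    show ‖((M : ℝ) + 1)⁻¹ • ∑ i, (if Visible R K M y i then cone k M x (y i).1 • (y i).2 else (0 : V3))‖ ≤
      K * (((M : ℝ) + 1)⁻¹ * ∑ i, (if Visible R K M y i then cone k M x (y i).1 else (0 : ℝ)))
    rw [norm_smul, norm_inv, Real.norm_of_nonneg (by positivity : (0 : ℝ) ≤ (M : ℝ) + 1), mul_left_comm,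
      Finset.mul_sum]
    refine mul_le_mul_of_nonneg_left ((norm_sum_le _ _).trans (Finset.sum_le_sum fun i _ => ?_)) (by positivity)
    split_ifs with h
    · rw [norm_smul, Real.norm_of_nonneg (hc i), mul_comm]
      exact mul_le_mul_of_nonneg_right h.1 (hc i)
    · simp
  have he0 : 0 ≤ e :=
    mul_nonneg (by positivity) (Finset.sum_nonneg fun i _ => by
      split_ifs; exacts [div_nonneg (mul_nonneg (hc i) (sq_nonneg _)) zero_le_two, le_rfl])
  have he : e ≤ K ^ 2 / 2 * ρ := by
    show ((M : ℝ) + 1)⁻¹ * ∑ i, (if Visible R K M y i then cone k M x (y i).1 * ‖(y i).2‖ ^ 2 / 2 else (0 : ℝ)) ≤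
      K ^ 2 / 2 * (((M : ℝ) + 1)⁻¹ * ∑ i, (if Visible R K M y i then cone k M x (y i).1 else (0 : ℝ)))
    rw [mul_left_comm]
    refine mul_le_mul_of_nonneg_left ?_ (by positivity)
    rw [Finset.mul_sum]
    refine Finset.sum_le_sum fun i _ => ?_
    split_ifs with h
    · have hv2 : ‖(y i).2‖ ^ 2 ≤ K ^ 2 := pow_le_pow_left₀ (norm_nonneg _) h.1 2
      calc cone k M x (y i).1 * ‖(y i).2‖ ^ 2 / 2 ≤ cone k M x (y i).1 * K ^ 2 / 2 := by gcongr; exact hc i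
        _ = K ^ 2 / 2 * cone k M x (y i).1 := by ring
    · simp
  have hw : ‖w‖ ≤ K := by
    rcases hρ0.eq_or_lt with hρz | hρpos
    · show ‖ρ⁻¹ • m‖ ≤ K
      rw [← hρz, inv_zero, zero_smul, norm_zero]; exact hK
    · show ‖ρ⁻¹ • m‖ ≤ K
      rw [norm_smul, norm_inv, Real.norm_of_nonneg hρ0]
      calc ρ⁻¹ * ‖m‖ ≤ ρ⁻¹ * (K * ρ) := mul_le_mul_of_nonneg_left hm (by positivity)
        _ = K := by field_simp
  have heρ : 0 ≤ e / ρ ∧ e / ρ ≤ K ^ 2 / 2 := by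
    rcases hρ0.eq_or_lt with hρz | hρpos
    exacts [by rw [← hρz, div_zero]; exact ⟨le_rfl, by positivity⟩, ⟨div_nonneg he0 hρ0, (div_le_iff₀ hρpos).2 he⟩]
  have hdiff : |e / ρ - ‖w‖ ^ 2 / 2| ≤ K ^ 2 / 2 := by
    have hw2 : ‖w‖ ^ 2 / 2 ≤ K ^ 2 / 2 :=
      div_le_div_of_nonneg_right (pow_le_pow_left₀ (norm_nonneg _) hw 2) zero_le_two
    rw [abs_sub_le_iff]
    constructor <;> nlinarith [heρ.1, heρ.2, sq_nonneg ‖w‖]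
  have hZb : 0 ≤ Zb := (abs_nonneg _).trans (hZ 0 ⟨le_rfl, by positivity⟩)
  have hZa : |hsCompressibility (min ρ 2 * σ' ^ 3)| ≤ Zb :=
    hZ _ ⟨mul_nonneg (le_min hρ0 zero_le_two) (by positivity),
      mul_le_mul_of_nonneg_right (min_le_right _ _) (by positivity)⟩
  have hp : |p| ≤ K ^ 2 * Zb / 3 * ρ := by
    show |ρ * (2 / 3 * (e / ρ - ‖w‖ ^ 2 / 2)) * hsCompressibility (min ρ 2 * σ' ^ 3)| ≤ _
    rw [abs_mul, abs_mul, abs_of_nonneg hρ0, abs_mul, abs_of_nonneg (by norm_num : (0 : ℝ) ≤ 2 / 3)]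
    calc ρ * (2 / 3 * |e / ρ - ‖w‖ ^ 2 / 2|) * |hsCompressibility (min ρ 2 * σ' ^ 3)|
        ≤ ρ * (2 / 3 * (K ^ 2 / 2)) * Zb := by gcongr
      _ = K ^ 2 * Zb / 3 * ρ := by ring
  have h1 : |⟪m, w⟫_ℝ| ≤ K ^ 2 * ρ :=
    calc |⟪m, w⟫_ℝ| ≤ ‖m‖ * ‖w‖ := abs_real_inner_le_norm _ _
      _ ≤ K * ρ * K := mul_le_mul hm hw (norm_nonneg _) (by positivity)
      _ = K ^ 2 * ρ := by ring
  calc |⟪m, w⟫_ℝ + 3 * p| ≤ |⟪m, w⟫_ℝ| + 3 * |p| := by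
        refine (abs_add_le _ _).trans ?_
        rw [abs_mul, abs_of_pos (by norm_num : (0 : ℝ) < 3)]
    _ ≤ K ^ 2 * ρ + 3 * (K ^ 2 * Zb / 3 * ρ) := add_le_add h1 (by linarith)
    _ = K ^ 2 * (1 + Zb) * ρ := by ring
    _ ≤ K ^ 2 * (1 + Zb) * D := mul_le_mul_of_nonneg_left hρD (by positivity)
    _ = D * K ^ 2 * (1 + Zb) := by ring

/-- **Bound of the diagonal Euler flux at one configuration** (`𝕋³` has volume `1`; Bochner junk `0`
included): `|flux(y)| ≤ (M+1) β D K² (1 + Zb)` as soon as the visible block density of `y` is at most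
`D` everywhere. -/
theorem abs_diagFlux_le {R K k σ' β D Zb : ℝ} {M : ℕ} (hK : 0 ≤ K) (hk : 0 ≤ k) (hσ : 0 ≤ σ') (hβ : 0 ≤ β)
    (hZ : ∀ η ∈ Set.Icc 0 (2 * σ' ^ 3), |hsCompressibility η| ≤ Zb) (y : Cfg M)
    (hD : ∀ x, ((M : ℝ) + 1)⁻¹ * ∑ i, (if Visible R K M y i then cone k M x (y i).1 else 0) ≤ D) :
    |((M : ℝ) + 1) * ∫ x,
        β * (let ρ : ℝ := ((M : ℝ) + 1)⁻¹ * ∑ i, (if Visible R K M y i then cone k M x (y i).1 else 0)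
          let m : V3 := ((M : ℝ) + 1)⁻¹ • ∑ i, (if Visible R K M y i then cone k M x (y i).1 • (y i).2 else 0)
          let e : ℝ := ((M : ℝ) + 1)⁻¹ * ∑ i, (if Visible R K M y i then cone k M x (y i).1 * ‖(y i).2‖ ^ 2 / 2 else 0)
          let w : V3 := ρ⁻¹ • m
          let p : ℝ := ρ * (2 / 3 * (e / ρ - ‖w‖ ^ 2 / 2)) * hsCompressibility (min ρ 2 * σ' ^ 3)
          ⟪m, w⟫_ℝ + 3 * p)| ≤ ((M : ℝ) + 1) * (β * (D * K ^ 2 * (1 + Zb))) := by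
  rw [abs_mul, abs_of_nonneg (by positivity : (0 : ℝ) ≤ (M : ℝ) + 1)]
  refine mul_le_mul_of_nonneg_left ?_ (by positivity)
  rw [← Real.norm_eq_abs]
  refine le_trans (norm_integral_le_of_norm_le_const (C := β * (D * K ^ 2 * (1 + Zb))) (ae_of_all _ fun x => ?_))
    (by rw [probReal_univ, mul_one])
  rw [Real.norm_eq_abs, abs_mul, abs_of_nonneg hβ]
  exact mul_le_mul_of_nonneg_left (abs_diagFluxDensity_le hK hk hσ hZ y x (hD x)) hβ


/-- **Window bound of the diagonal Euler flux along an orbit**: for `0 ≤ τ`, `0 ≤ β`, `0 < R`, `0 < k`,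
`R (M+1)^{-1/3} ≤ 4`, `0 ≤ K`, `0 ≤ σ'`, `|Z| ≤ Zb` on `[0, 2σ'³]`, along the orbit of EVERY phase point
`|∫₀^τ flux(Φ_s z) ds| ≤ τ (M+1) β C₃`, `C₃ = 3 (8 + R/k)³ K² (1 + Zb)` (no integrability in time needed). -/
theorem abs_windowFlux_diag_le {R K k σ' β Zb τ : ℝ} {ε : ℕ → ℝ} (Φ : FlowFamily ε) {M : ℕ} (hτ : 0 ≤ τ)
    (hβ : 0 ≤ β) (hR : 0 < R) (hk : 0 < k) (hRν : R * ((M : ℝ) + 1) ^ (-(1 / 3 : ℝ)) ≤ 4) (hK : 0 ≤ K)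
    (hσ : 0 ≤ σ') (hZ : ∀ η ∈ Set.Icc 0 (2 * σ' ^ 3), |hsCompressibility η| ≤ Zb) (z : Cfg M) :
    |∫ s in (0 : ℝ)..τ, ((M : ℝ) + 1) * ∫ x,
        β * (let y : Cfg M := (Φ M).flow s z
          let ρ : ℝ := ((M : ℝ) + 1)⁻¹ * ∑ i, (if Visible R K M y i then cone k M x (y i).1 else 0)
          let m : V3 := ((M : ℝ) + 1)⁻¹ • ∑ i, (if Visible R K M y i then cone k M x (y i).1 • (y i).2 else 0)
          let e : ℝ := ((M : ℝ) + 1)⁻¹ * ∑ i, (if Visible R K M y i then cone k M x (y i).1 * ‖(y i).2‖ ^ 2 / 2 else 0)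
          let w : V3 := ρ⁻¹ • m
          let p : ℝ := ρ * (2 / 3 * (e / ρ - ‖w‖ ^ 2 / 2)) * hsCompressibility (min ρ 2 * σ' ^ 3)
          ⟪m, w⟫_ℝ + 3 * p)| ≤ τ * (((M : ℝ) + 1) * (β * (3 * (8 + R / k) ^ 3 * K ^ 2 * (1 + Zb)))) := by
  rw [← Real.norm_eq_abs]
  refine (intervalIntegral.norm_integral_le_of_norm_le_const
    (C := ((M : ℝ) + 1) * (β * (3 * (8 + R / k) ^ 3 * K ^ 2 * (1 + Zb)))) fun s _ => ?_).trans (le_of_eq ?_)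
  · rw [Real.norm_eq_abs]
    exact abs_diagFlux_le hK hk.le hσ hβ hZ _ fun x => visDensity_le_geometric hR hk hRν _ x
  · rw [sub_zero, abs_of_nonneg hτ, mul_comm]

end Flux

/-! ## The registered helper stub -/

/-- **Registered helper stub `stub_visCoreDiagFluxBound`** (flux part (B) of the lead's helper target
`stub_visCoreDiagLowerBound`, RINGS-VLFG § 1, skeleton v8, crux stmt-17740): sorry-free conjunction of
`visDensity_le_geometric` (§ 1), `abs_diagFlux_le` and `abs_windowFlux_diag_le` (§ 2), restated with fully
qualified names (the registered one-line signature). -/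
theorem stub_visCoreDiagFluxBound : (∀ (R K k : ℝ) (M : ℕ), 0 < R → 0 < k → R * ((M : ℝ) + 1) ^ (-(1 / 3 : ℝ)) ≤ 4 → ∀ (y : Summit.AtomisticToContinuum.HydrodynamicLimit.Theorems.LTEInBand.Cfg M) (x : UnitAddTorus (Fin 3)), (((M : ℝ) + 1)⁻¹ * ∑ i, (if Summit.AtomisticToContinuum.HydrodynamicLimit.Theorems.LTEInBand.Visible R K M y i then Summit.AtomisticToContinuum.HydrodynamicLimit.Theorems.LTEInBand.cone k M x (y i).1 else 0)) ≤ 3 * (8 + R / k) ^ 3) ∧ (∀ (R K k σ' β D Zb : ℝ) (M : ℕ), 0 ≤ K → 0 ≤ k → 0 ≤ σ' → 0 ≤ β → (∀ η ∈ Set.Icc (0 : ℝ) (2 * σ' ^ 3), |Literature.MathematicalPhysics.KineticTheory.hsCompressibility η| ≤ Zb) → ∀ y₀ : Summit.AtomisticToContinuum.HydrodynamicLimit.Theorems.LTEInBand.Cfg M, (∀ x : UnitAddTorus (Fin 3), (((M : ℝ) + 1)⁻¹ * ∑ i, (if Summit.AtomisticToContinuum.HydrodynamicLimit.Theorems.LTEInBand.Visible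 R K M y₀ i then Summit.AtomisticToContinuum.HydrodynamicLimit.Theorems.LTEInBand.cone k M x (y₀ i).1 else 0)) ≤ D) → |((M : ℝ) + 1) * ∫ x : UnitAddTorus (Fin 3), β * (let y : Summit.AtomisticToContinuum.HydrodynamicLimit.Theorems.LTEInBand.Cfg M := y₀; let ρ : ℝ := ((M : ℝ) + 1)⁻¹ * ∑ i, (if Summit.AtomisticToContinuum.HydrodynamicLimit.Theorems.LTEInBand.Visible R K M y i then Summit.AtomisticToContinuum.HydrodynamicLimit.Theorems.LTEInBand.cone k M x (y i).1 else 0); let m : EuclideanSpace ℝ (Fin 3) := ((M : ℝ) + 1)⁻¹ • ∑ i, (if Summit.AtomisticToContinuum.HydrodynamicLimit.Theorems.LTEInBand.Visible R K M y i then Summit.AtomisticToContinuum.HydrodynamicLimit.Theorems.LTEInBand.cone k M x (y i).1 • (y i).2 else 0); let e : ℝ := ((M : ℝ) + 1)⁻¹ * ∑ i, (if Summit.AtomisticToContinuum.HydrodynamicLimit.Theorems.LTEInBand.Visible R K M y i then Summit.AtomisticToContinuum.HydrodynamicLimit.Theorems.LTEInBand.cone k M x (y i).1 * ‖(y i).2‖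 ^ 2 / 2 else 0); let w : EuclideanSpace ℝ (Fin 3) := ρ⁻¹ • m; let p : ℝ := ρ * (2 / 3 * (e / ρ - ‖w‖ ^ 2 / 2)) * Literature.MathematicalPhysics.KineticTheory.hsCompressibility (min ρ 2 * σ' ^ 3); ⟪m, w⟫_ℝ + 3 * p)| ≤ ((M : ℝ) + 1) * (β * (D * K ^ 2 * (1 + Zb)))) ∧ (∀ (R K k σ' β Zb τ : ℝ) (ε : ℕ → ℝ) (Φ : Summit.AtomisticToContinuum.HydrodynamicLimit.Theorems.LTEInBand.FlowFamily ε) (M : ℕ), 0 ≤ τ → 0 ≤ β → 0 < R → 0 < k → R * ((M : ℝ) + 1) ^ (-(1 / 3 : ℝ)) ≤ 4 → 0 ≤ K → 0 ≤ σ' → (∀ η ∈ Set.Icc (0 : ℝ) (2 * σ' ^ 3), |Literature.MathematicalPhysics.KineticTheory.hsCompressibility η| ≤ Zb) → ∀ z : Summit.AtomisticToContinuum.HydrodynamicLimit.Theorems.LTEInBand.Cfg M, |∫ s in (0 : ℝ)..τ, ((M : ℝ) + 1) * ∫ x : UnitAddTorus (Fin 3), β * (let y : Summit.AtomisticToContinuum.HydrodynamicLimit.Theorems.LTEInBand.Cfg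 M := (Φ M).flow s z; let ρ : ℝ := ((M : ℝ) + 1)⁻¹ * ∑ i, (if Summit.AtomisticToContinuum.HydrodynamicLimit.Theorems.LTEInBand.Visible R K M y i then Summit.AtomisticToContinuum.HydrodynamicLimit.Theorems.LTEInBand.cone k M x (y i).1 else 0); let m : EuclideanSpace ℝ (Fin 3) := ((M : ℝ) + 1)⁻¹ • ∑ i, (if Summit.AtomisticToContinuum.HydrodynamicLimit.Theorems.LTEInBand.Visible R K M y i then Summit.AtomisticToContinuum.HydrodynamicLimit.Theorems.LTEInBand.cone k M x (y i).1 • (y i).2 else 0); let e : ℝ := ((M : ℝ) + 1)⁻¹ * ∑ i, (if Summit.AtomisticToContinuum.HydrodynamicLimit.Theorems.LTEInBand.Visible R K M y i then Summit.AtomisticToContinuum.HydrodynamicLimit.Theorems.LTEInBand.cone k M x (y i).1 * ‖(y i).2‖ ^ 2 / 2 else 0); let w : EuclideanSpace ℝ (Fin 3) := ρ⁻¹ • m; let p : ℝ := ρ * (2 / 3 * (e / ρ - ‖w‖ ^ 2 / 2)) * Literature.MathematicalPhysics.KineticTheory.hsCompressibility (min ρ 2 * σ' ^ 3); ⟪m,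 w⟫_ℝ + 3 * p)| ≤ τ * (((M : ℝ) + 1) * (β * (3 * (8 + R / k) ^ 3 * K ^ 2 * (1 + Zb))))) :=
  ⟨fun _ _ _ _ hR hk hRν y x => visDensity_le_geometric hR hk hRν y x,
    fun _ _ _ _ _ _ _ _ hK hk hσ hβ hZ y hD => abs_diagFlux_le hK hk hσ hβ hZ y hD,
    fun _ _ _ _ _ _ _ _ Φ _ hτ hβ hR hk hRν hK hσ hZ z => abs_windowFlux_diag_le Φ hτ hβ hR hk hRν hK hσ hZ z⟩

end Summit.AtomisticToContinuum.HydrodynamicLimit.Theorems.LTEInBand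

end
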